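import Mathlib
import Summits.RiemannHypothesis.RiemannHypothesis.Theses.RuelleBand
import Literature.NumberTheory.LFunctions.WeilExplicit
import Literature.NumberTheory.LFunctions.ZetaScrew

/-!
# Sketch — first lemmas for the crux ideas on `CofiniteCriticalLine` (stmt-RiemannHypothesis-2064),
ideator 2, round 1.

Card A (`weil-inertia-pontryagin-index`): the cofinite rung is an INDEX.
Card B (`krein-one-step-external-primes`): the index is a zero count of orthogonal polynomials of
arithmetic Toeplitz sections (Kreĭn's theorem) and grows only at EXTERNAL one-step extensions.
Everything here is a STATEMENT (`def … : Prop`); nothing is claimed proved.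
-/

noncomputable section

open Complex Set MeasureTheory Finset
open scoped BigOperators ComplexConjugate

namespace Summit.RiemannHypothesis.RiemannHypothesis.Cruxes.CofiniteCriticalLine.Ideator2

open Summit.RiemannHypothesis.RiemannHypothesis.Theses.RuelleBand
open Literature.NumberTheory.LFunctions

/-! ## Card A — negative index of inertia of the Weil form -/

/-- The Weil form has negative index of inertia `≤ N` on the window `[-a, a]`: no `(N+1)`-tuple of
Weil test functions supported in `[-a,a]` spans a subspace on which `Re Q` is negative definite
(`Q = weilQuadratic`; equivalently every Gram matrix `[W(gᵢ ⋆ g̃ⱼ)]` has at most `N` negative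
eigenvalues). `N = 0` is `WeilPositivityOn a`. -/
def WeilIndexOnLE (a : ℝ) (N : ℕ) : Prop :=
  ∀ g : Fin (N + 1) → ℝ → ℂ, (∀ i, IsWeilTest (g i)) → (∀ i, tsupport (g i) ⊆ Icc (-a) a) →
    ∃ c : Fin (N + 1) → ℂ, c ≠ 0 ∧ 0 ≤ (weilQuadratic (fun t => ∑ i, c i * g i t)).re

/-- Negative index `≤ N` on all compactly supported test functions (no window). -/
def WeilIndexLE (N : ℕ) : Prop :=
  ∀ g : Fin (N + 1) → ℝ → ℂ, (∀ i, IsWeilTest (g i)) →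
    ∃ c : Fin (N + 1) → ℂ, c ≠ 0 ∧ 0 ≤ (weilQuadratic (fun t => ∑ i, c i * g i t)).re

/-- C⁺ of card A: the Weil form has FINITELY MANY NEGATIVE SQUARES (is of Pontryagin type). -/
def BoundedWeilIndex : Prop := ∃ N : ℕ, WeilIndexLE N

/-- FIRST LEMMA of card A (the ENGINE of rung #5, analogue of `RealisationToAsymptotic`):
finitely many negative squares ⟹ all but finitely many zeros on the line. Contrapositive: `N+1`
off-line quadruples at heights `γ₀ < … < γ_N` give `N+1` test functions `gⱼ(t) = t·h_L(t)e^{-iγⱼt}`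
(odd bump × phase, `L³ δⱼ² ≫ log γⱼ`) whose Gram matrix is negative definite, via
`explicit_formula_holds` and the window count `N(t+1) − N(t) ≪ log t`. -/
def IndexEngine : Prop := BoundedWeilIndex → CofiniteCriticalLine

/-- CALIBRATION (Bombieri 2000, abstract + Thms 8–10: "the number of negative eigenvalues is
precisely one half of the number of zeros failing RH"): under the crux, `Re Q = (positive form from
the on-line zeros) + (Hermitian form of rank ≤ 4m)`, so the index is `≤ 2m`. -/
def IndexCalibration : Prop := CofiniteCriticalLine → BoundedWeilIndex

/-- Each window has FINITE index (Yoshida 1992; in tree via the compact form embedding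
`ConnesConsaniMoscovici2025_thm_3_6` + `bddBelow_weilQuadratic_sphere`). Unconditional rung. -/
def WindowIndexFinite : Prop := ∀ a : ℝ, ∃ N : ℕ, WeilIndexOnLE a N

/-- The index is monotone in the window (restriction of a form to a smaller space). Trivial. -/
def WindowIndexMono : Prop := ∀ a b : ℝ, ∀ N : ℕ, a ≤ b → WeilIndexOnLE b N → WeilIndexOnLE a N

/-- THE BET of card A (FIN-strength, = the crux by `IndexEngine`/`IndexCalibration`):
the window index is bounded uniformly in the window. RH is the case `N = 0` for all `a`. -/
def UniformWindowIndex : Prop := ∃ N : ℕ, ∀ a : ℝ, WeilIndexOnLE a N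

/-- RH ⟺ index zero on every window (`N = 0` is `WeilPositivityOn`, and
`riemannHypothesis_iff_forall_weilPositivityOn` is proved in the tree). Sanity rung. -/
def IndexZero_iff_RH : Prop := (∀ a : ℝ, 0 < a → WeilIndexOnLE a 0) ↔ RiemannHypothesis

/-- ROUTE-NATIVE typing (rung #5 analogue of `BandRealisation`): a PONTRYAGIN realisation —
a Hilbert space with a self-adjoint unitary involution `J` whose negative spectral subspace
`range (id - J)` is finite-dimensional, and a one-parameter group `T` of `J`-UNITARY operators
(`T(t)† J T(t) = J`) having every non-trivial zero as a joint eigenvalue with character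
`e^{t(ρ - 1/2)}`. Canonical candidate witness: the completion of test functions under the Weil form
(translations are `Q`-isometric), which is a Pontryagin space iff `BoundedWeilIndex`. -/
def PontryaginRealisation : Prop :=
  ∃ (H : Type) (_ : NormedAddCommGroup H) (_ : InnerProductSpace ℂ H) (_ : CompleteSpace H)
    (J : H →L[ℂ] H) (T : ℝ → H →L[ℂ] H),
    IsSelfAdjoint J ∧ J.comp J = ContinuousLinearMap.id ℂ H ∧
    FiniteDimensional ℂ (LinearMap.range ((ContinuousLinearMap.id ℂ H - J : H →L[ℂ] H) : H →ₗ[ℂ] H)) ∧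
    T 0 = ContinuousLinearMap.id ℂ H ∧ (∀ s t : ℝ, T (s + t) = (T s).comp (T t)) ∧
    (∀ t : ℝ, (ContinuousLinearMap.adjoint (T t)).comp (J.comp (T t)) = J) ∧
    (∀ s : ℂ, riemannZeta s = 0 → 0 < s.re → s.re < 1 →
      ∃ v : H, v ≠ 0 ∧ ∀ t : ℝ, T t v = Complex.exp (↑t * (s - 1 / 2)) • v)

/-- PONTRYAGIN ENGINE (elementary, provable now, ~M): eigenvectors of a `J`-unitary operator for
eigenvalues of modulus `> 1` span a `J`-NEUTRAL subspace, and a neutral subspace meets the positive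
subspace `ker (id - J)` trivially, so its dimension is `≤ dim range (id - J)`; hence at most
`2κ` non-unimodular joint characters, i.e. finitely many `ρ` with `Re ρ ≠ 1/2`
(Pontryagin 1944 / Iohvidov–Kreĭn–Langer; finite-dimensional form: Gohberg–Lancaster–Rodman 2005
Cor. 5.2.1 area, p. 91: `i₋(H) ≥ ½ · #non-real eigenvalues`). -/
def PontryaginEngine : Prop := PontryaginRealisation → CofiniteCriticalLine

/-- … and its calibration (diagonal group on `ℓ²` for the on-line zeros ⊕ one hyperbolic `2×2`
block `J = σₓ` per off-line pair; analogue of `AsymptoticToRealisation`). -/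
def PontryaginCalibration : Prop := CofiniteCriticalLine → PontryaginRealisation

/-- SCREW-FUNCTION face of the same index (Suzuki 2023 Thm 1.2 is the case `N = 0`; Kreĭn–Langer
1977 class `𝔊_κ`): Suzuki's kernel `G(t,u) = Ψ(t) + Ψ(u) - Ψ(t-u)` (`zetaScrewKernel`, real
symmetric) has at most `N` negative squares: no `N+1` linearly independent real coefficient
vectors span a negative-definite subspace of any finite Gram matrix. -/
def ScrewKernelIndexLE (N : ℕ) : Prop :=
  ∀ (n : ℕ) (t : Fin n → ℝ) (x : Fin (N + 1) → Fin n → ℝ), LinearIndependent ℝ x →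
    ∃ c : Fin (N + 1) → ℝ, c ≠ 0 ∧
      0 ≤ ∑ i, ∑ j, zetaScrewKernel (t i) (t j) * (∑ k, c k * x k i) * (∑ k, c k * x k j)

/-- Transfer, screw form: finitely many negative squares of the screw kernel ⟺ the crux
(`⟸` by Suzuki2023_thm11_series `Ψ(t) = ∑_γ (1 - cos γt)/γ²`; `⟹` as in `IndexEngine`). -/
def ScrewIndexTransfer : Prop := (∃ N, ScrewKernelIndexLE N) ↔ CofiniteCriticalLine

/-! ## Card B — Toeplitz sections of the Weil form, Kreĭn's theorem, one-step external extensions -/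

/-- Grid comb: translates of ONE test function `φ` along the arithmetic progression `h·{0,…,n}`. -/
def gridComb (φ : ℝ → ℂ) (h : ℝ) {n : ℕ} (c : Fin (n + 1) → ℂ) : ℝ → ℂ :=
  fun t => ∑ k, c k * φ (t - (k : ℕ) * h)

/-- The arithmetic Toeplitz data: `w(m) := W(τ_{mh}(φ ⋆ φ̃))`, an explicit number built from the
prime powers `n` with `|log n - mh| ≤ |supp (φ ⋆ φ̃)|`, digamma values and the pole. -/
def toeplitzEntry (φ : ℝ → ℂ) (h : ℝ) (m : ℤ) : ℂ :=
  weilFunctional (fun t => weilConv φ (weilReflect φ) (t - m * h))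

/-- The Hermitian Toeplitz section `Ω_n(φ,h) = [w(j - k)]`. -/
def toeplitzSection (φ : ℝ → ℂ) (h : ℝ) (n : ℕ) : Matrix (Fin (n + 1)) (Fin (n + 1)) ℂ :=
  Matrix.of fun j k => toeplitzEntry φ h ((j : ℕ) - (k : ℕ) : ℤ)

/-- FIRST LEMMA of card B (provable now, S/M: bilinearity of `W`, `(τ_a φ) ⋆ (τ_b φ)~ = τ_{a-b}(φ ⋆ φ̃)`):
on grid combs the Weil form IS a Toeplitz quadratic form with arithmetic entries. -/
def ToeplitzSections : Prop :=
  ∀ (φ : ℝ → ℂ), IsWeilTest φ → ∀ (h : ℝ) (n : ℕ) (c : Fin (n + 1) → ℂ),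
    weilQuadratic (gridComb φ h c) = ∑ j, ∑ k, c j * conj (c k) * toeplitzEntry φ h ((j : ℕ) - (k : ℕ) : ℤ)

/-- KREĬN'S THEOREM (1933; Gohberg–Lancaster–Rodman 2005 Thm 3.2.3, READ): for a Hermitian
Toeplitz family with non-vanishing leading minors `d_k` and `d_n d_{n-1} > 0`, the orthogonal
polynomial `s_n(z) = ∑ ωᵢ zⁱ`, `ω = Ω_n⁻¹ e_last`, has no zeros on the unit circle and exactly
`i₋(Ω_n)` zeros OUTSIDE the closed unit disc (counted with multiplicity). Pure linear algebra
(the LEVER of card B; Literature-grade, provable in Lean with effort). -/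
def KreinZeroCount : Prop :=
  ∀ (n : ℕ) (w : ℤ → ℂ), (∀ m, w (-m) = conj (w m)) → 1 ≤ n →
    let Ω : (k : ℕ) → Matrix (Fin (k + 1)) (Fin (k + 1)) ℂ :=
      fun k => Matrix.of fun i j => w ((i : ℕ) - (j : ℕ) : ℤ)
    (∀ k ≤ n, (Ω k).det ≠ 0) → 0 < ((Ω n).det * (Ω (n - 1)).det).re →
    ∀ hΩ : (Ω n).IsHermitian,
      let ω : Fin (n + 1) → ℂ := (Ω n)⁻¹.mulVec (Pi.single (Fin.last n) 1)
      let s : Polynomial ℂ := ∑ i : Fin (n + 1), Polynomial.C (ω i) * Polynomial.X ^ (i : ℕ)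
      (s.roots.filter fun z => 1 < ‖z‖).card =
        (Finset.univ.filter fun i => hΩ.eigenvalues i < 0).card

/-- C⁺ of card B: along every grid and bump, the number of zeros of the Weil–Szegő orthogonal
polynomials outside the unit disc is uniformly bounded — by Kreĭn's theorem the Toeplitz-section
form of `BoundedWeilIndex`; by the Ellis–Gohberg ONE-STEP theorem (GLR Thm 3.3.1) it says: only
finitely many extension steps `n ↦ n+1` are EXTERNAL (the new entry `w(n+1)`, a prime sum at scale
`(n+1)h`, falls outside the Schur disc predicted by `w(0..n)`), uniformly in `(φ, h)`. -/
def BoundedToeplitzIndex : Prop :=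
  ∃ K : ℕ, ∀ (φ : ℝ → ℂ), IsWeilTest φ → ∀ (h : ℝ) (n : ℕ),
    ∀ hΩ : (toeplitzSection φ h n).IsHermitian,
      (Finset.univ.filter fun i => hΩ.eigenvalues i < 0).card ≤ K

/-- Exhaustion (density of grid combs in the test space + continuity of `Q`): the Toeplitz-section
index bound is the full index bound. With `IndexEngine` this makes card B conclude the crux. -/
def ToeplitzExhaustion : Prop := BoundedToeplitzIndex → BoundedWeilIndex

end Summit.RiemannHypothesis.RiemannHypothesis.Cruxes.CofiniteCriticalLine.Ideator2

end
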